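import Literature.AlgebraicGeometry.HodgeTheory.PicardLefschetzExchangedPairOfOneNode
import Literature.AlgebraicGeometry.HodgeTheory.NodalFormBranches
import HarnessLib

/-!
# The one-node Picard–Lefschetz binder in a GENERAL pencil direction — `picardLefschetz_oneNode` and
# `picardLefschetz_exchangedPair` are THEOREMS (programme «PL1-GENERAL»)

Family `hodge`, layer `Literature/AlgebraicGeometry/HodgeTheory`. Theorems only. Written by the prover seat
`hodge-nonav-20241-p1` (g18, cell `hodge-nonav`) for crux K1-B `VeryGeneralSignCommutatorsInHg` of route
`HodgeConjecture/SignSymmetricPowers` (stmt-HodgeConjecture-19716): the two keyed Picard–Lefschetz binders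
`picardLefschetz_oneNode` (hPL₁) and `picardLefschetz_exchangedPair` (hPL₂exch) of `PicardLefschetzNodalFormsKeyed` become
theorems in full generality.

THE ARGUMENT (direction homotopy). prover-Bx's `NodalPencil.picardLefschetz_oneNode_monomial` proves hPL₁ for the monomial
directions `a′ • xᵢ^d`. Given a one-nodal `f₁` (node `p`) and ANY direction `g` with `g(p) ≠ 0`, pick `i` with `pᵢ ≠ 0` and
`g′ := (g(p)/pᵢ^d) • xᵢ^d`, so that `g′(p) = g(p)`. In the plane `F_{u,v} = f₁ + u g′ + v g` the discriminant near `0` is ONE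
smooth branch `φ = 0` with strict differential `g(p)·(u + v)` (`DiscriminantBranches.exists_nodal_branches`, `k = 1`); the
segment of circles `θ ↦ F_{q(s,θ)}`, `q(s,θ) = (s·εe^{2πiθ}, (1−s)·εe^{2πiθ})`, `s ∈ [0,1]`, joins the `g`-circle (`s = 0`)
to the `g′`-circle (`s = 1`) through NONSINGULAR members (`|φ(q) − g(p)εe^{2πiθ}| ≤ ½|g(p)|ε`), so the two pencil circles
are conjugate loops of `U(ℂ)` (`MeridianConj.mk_eq_conj_of_square`); the monomial theorem's Picard–Lefschetz data on the
`g′`-circle (its even-dimensional rider follows from that of the `g`-circle, the transports being conjugate) are carried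
back along the track by `IsPicardLefschetzData.exists_of_leash` and `IsPicardLefschetzData.of_loopClassUniv_eq`.

* `picardLefschetz_oneNode_holds : picardLefschetz_oneNode`;
* `picardLefschetz_exchangedPair_holds : picardLefschetz_exchangedPair` (:= `picardLefschetz_exchangedPair_of_oneNode _`).

Honest scope: the Picard–Lefschetz package of route B is now unconditional; nothing here says HC is proved; rung F-H1
not moved (K1-B still rests on hCDK and hN).

## References

* [VoisinHodgeII2003] C. Voisin, Hodge Theory and Complex Algebraic Geometry II, CUP 2003, §2.3.1–2.3.2, §3.1.2,
  §3.2.1 Thm. 3.16, Cor. 3.17, Rem. 3.21.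
* [ArnoldGuseinzadeVarchenko2012] AGZV II, Part I §1.3, §2.1.
* [Lamotke1981] K. Lamotke, The topology of complex projective varieties after S. Lefschetz, §6.
* [Hatcher2002] A. Hatcher, Algebraic Topology, §1.1 Lemma 1.19.
-/

noncomputable section

open CategoryTheory AlgebraicGeometry MvPolynomial
open _root_.Topology _root_.Filter
open scoped unitInterval
open Literature.AlgebraicTopology.SingularHomology
open Literature.AlgebraicGeometry.Motives Literature.AlgebraicGeometry.Motives.UniversalHypersurface
open Literature.AlgebraicGeometry.HodgeTheory.UniversalHypersurface
open Literature.AlgebraicGeometry.HodgeTheory.BettiUniverse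
open Literature.AlgebraicGeometry.FundamentalGroup

namespace Literature.AlgebraicGeometry.HodgeTheory

variable {n d : ℕ}

/-! ### §1 `picardLefschetz_oneNode` is a theorem -/

set_option maxHeartbeats 800000 in
/-- **The one-node Picard–Lefschetz binder `picardLefschetz_oneNode` HOLDS** (every pencil direction `g` with
`g(p) ≠ 0`): from prover-Bx's monomial theorem by the direction homotopy of the module docstring.
[cite: VoisinHodgeII2003, §3.2.1 Thm. 3.16, Cor. 3.17, Rem. 3.21, §2.3.1–2.3.2 and §3.1.2]
[cite: ArnoldGuseinzadeVarchenko2012, Part I §1.3 and §2.1] [cite: Lamotke1981, §6] [cite: Hatcher2002, §1.1 Lemma 1.19] -/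
theorem picardLefschetz_oneNode_holds : picardLefschetz_oneNode := by
  intro n d hn hd f₁ g hf₁ hg p hnod hgp
  classical
  -- the monomial direction `g' = a' • xᵢ^d` with `g'(p) = g(p)`
  obtain ⟨i, hpi⟩ : ∃ i, p i ≠ 0 := Function.ne_iff.1 (hnod.1 0).ne_zero
  have hpid : p i ^ d ≠ 0 := pow_ne_zero _ hpi
  set a' : ℂ := eval p g / p i ^ d with ha'
  set g' : MvPolynomial (Fin (n + 2)) ℂ := a' • X i ^ d with hg'def
  have hg' : g'.IsHomogeneous d := (homogeneousSubmodule (Fin (n + 2)) ℂ d).smul_mem a' (isHomogeneous_X_pow i d)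
  have hg'p : eval p g' = eval p g := by
    rw [hg'def, NodalPencil.eval_smul_X_pow, ha', div_mul_cancel₀ _ hpid]
  have hg'p0 : eval p g' ≠ 0 := by rw [hg'p]; exact hgp
  -- the monomial theorem for `(f₁, g')`
  obtain ⟨ε₀M, hε₀M, -, hM⟩ := NodalPencil.picardLefschetz_oneNode_monomial n d hn hd f₁ hf₁ p hnod i a' hg'p0
  -- the nonsingularity radius of the pencil `f₁ + c g`
  obtain ⟨ε₀S, hε₀S, hS⟩ := hnod.exists_isNonsingularForm_add_smul hd hf₁ hg (fun j => by fin_cases j; exact hgp)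
  -- one branch of the discriminant in the plane `f₁ + u g' + v g`
  obtain ⟨φ, -, N, hNo, h0N, hφ0, hφd, -, -, hΩ, -⟩ :=
    DiscriminantBranches.exists_nodal_branches (p := ![p]) (h := g) hf₁ hg' hg hnod
      (fun j => by fin_cases j; exact hg'p0)
  -- the strict-derivative estimate `|φ₀(q) - g(p)(q.1 + q.2)| ≤ ½|g(p)| |q|` on a ball inside `N`
  have hD : ∀ q : ℂ × ℂ, (eval (![p] 0) g' • ContinuousLinearMap.fst ℂ ℂ ℂ +
      eval (![p] 0) g • ContinuousLinearMap.snd ℂ ℂ ℂ) q = eval p g * (q.1 + q.2) := fun q => by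
    show eval p g' * q.1 + eval p g * q.2 = _
    rw [hg'p]; ring
  have hlo := (hφd 0).hasFDerivAt
  rw [hasFDerivAt_iff_isLittleO_nhds_zero] at hlo
  have hgpos : 0 < ‖eval p g‖ := norm_pos_iff.2 hgp
  obtain ⟨r, hr, hball⟩ := Metric.eventually_nhds_iff.1 ((hlo.def (half_pos hgpos)).and (hNo.mem_nhds h0N))
  -- the radius
  refine ⟨min (min ε₀S ε₀M) r, lt_min (lt_min hε₀S hε₀M) hr, fun c' hc' hlt =>
    hS c' hc' (hlt.trans_le ((min_le_left _ _).trans (min_le_left _ _))), ?_⟩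
  intro hU ε hε hεlt s' hs' γ hγ hrider
  have hεS : ε < ε₀S := hεlt.trans_le ((min_le_left _ _).trans (min_le_left _ _))
  have hεM : ε < ε₀M := hεlt.trans_le ((min_le_left _ _).trans (min_le_right _ _))
  have hεr : ε < r := hεlt.trans_le (min_le_right _ _)
  -- the circle points `w θ = ε e^{2πiθ}` and the homotopy `q(s, θ) = (s w, (1 - s) w)`
  set w : ℝ → ℂ := fun θ => (ε : ℂ) * Complex.exp (2 * Real.pi * Complex.I * (θ : ℂ)) with hwdef
  have hwn : ∀ θ, ‖w θ‖ = ε := fun θ => by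
    rw [hwdef]; dsimp only
    rw [norm_mul, Complex.norm_real, Real.norm_eq_abs, abs_of_pos hε,
      show (2 * Real.pi * Complex.I * (θ : ℂ)) = ((2 * Real.pi * θ : ℝ) : ℂ) * Complex.I by push_cast; ring,
      Complex.norm_exp_ofReal_mul_I, mul_one]
  have hw01 : w 1 = w 0 := by
    rw [hwdef]; dsimp only
    rw [Complex.ofReal_one, mul_one, Complex.exp_two_pi_mul_I, Complex.ofReal_zero, mul_zero, Complex.exp_zero]
  have hw0 : w 0 = ε := by
    rw [hwdef]; dsimp only; rw [Complex.ofReal_zero, mul_zero, Complex.exp_zero, mul_one]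
  set q : ℝ → ℝ → ℂ × ℂ := fun s θ => (((s : ℝ) : ℂ) * w θ, (((1 - s : ℝ)) : ℂ) * w θ) with hqdef
  have hq00 : q 0 0 = (0, (ε : ℂ)) := by rw [hqdef]; dsimp only; rw [hw0]; push_cast; ring_nf
  have hq10 : q 1 0 = ((ε : ℂ), 0) := by rw [hqdef]; dsimp only; rw [hw0]; push_cast; ring_nf
  have hq0θ : ∀ θ, q 0 θ = (0, w θ) := fun θ => by rw [hqdef]; dsimp only; push_cast; ring_nf
  have hq1θ : ∀ θ, q 1 θ = (w θ, 0) := fun θ => by rw [hqdef]; dsimp only; push_cast; ring_nf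
  have hqsum : ∀ s θ, (q s θ).1 + (q s θ).2 = w θ := fun s θ => by
    rw [hqdef]; dsimp only; push_cast; ring
  have hqn : ∀ s θ, 0 ≤ s → s ≤ 1 → ‖q s θ‖ ≤ ε := fun s θ hs0 hs1 => by
    rw [hqdef]; dsimp only
    rw [Prod.norm_def]
    dsimp only
    rw [norm_mul, hwn, norm_mul, hwn, Complex.norm_real, Complex.norm_real, Real.norm_eq_abs,
      Real.norm_eq_abs, abs_of_nonneg hs0, abs_of_nonneg (by linarith)]
    refine max_le ?_ ?_ <;> nlinarith
  -- nonsingularity along the homotopy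
  have hJ : ∀ s θ, 0 ≤ s → s ≤ 1 → SmoothHypersurface.IsNonsingularForm ℂ (f₁ + (q s θ).1 • g' + (q s θ).2 • g) := by
    intro s θ hs0 hs1
    have hdist : dist (q s θ) 0 < r := by rw [dist_zero_right]; exact (hqn s θ hs0 hs1).trans_lt hεr
    obtain ⟨hest, hmem⟩ := hball hdist
    rw [zero_add, hφ0 0, sub_zero, hD, hqsum] at hest
    refine (hΩ _ hmem).2 fun j => ?_
    obtain rfl : j = 0 := Subsingleton.elim _ _
    intro h0
    rw [h0, zero_sub, norm_neg, norm_mul, hwn] at hest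
    have := (hqn s θ hs0 hs1)
    nlinarith [hgpos, hε, norm_nonneg (q s θ)]
  -- the square in the plane and in `U(ℂ)`
  obtain ⟨P, hP⟩ := exists_planeMap (n := n) hf₁ hg' hg
  let Q : C(I × I, ↥{q : ℂ × ℂ | SmoothHypersurface.IsNonsingularForm ℂ (f₁ + q.1 • g' + q.2 • g)}) :=
    ⟨fun x => ⟨q x.1 x.2, hJ x.1 x.2 x.1.2.1 x.1.2.2⟩, by
      refine Continuous.subtype_mk ?_ _
      have hwc : Continuous fun x : I × I => w x.2 :=
        continuous_const.mul (Complex.continuous_exp.comp (continuous_const.mul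
          (Complex.continuous_ofReal.comp (continuous_subtype_val.comp continuous_snd))))
      refine Continuous.prodMk ?_ ?_
      · exact (Complex.continuous_ofReal.comp (continuous_subtype_val.comp continuous_fst)).mul hwc
      · exact (Complex.continuous_ofReal.comp ((continuous_const.sub
          (continuous_subtype_val.comp continuous_fst)))).mul hwc⟩
  set Φ : C(I × I, ComplexPoints (base ℂ n d)) := P.comp Q with hΦdef
  have hΦform : ∀ x : I × I, pointForm ℂ n d (Φ x) = f₁ + (q x.1 x.2).1 • g' + (q x.1 x.2).2 • g := fun x => hP (Q x)
  have hq1 : ∀ t : I, q t 1 = q t 0 := fun t => by rw [hqdef]; dsimp only; rw [hw01]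
  have hΦ1 : ∀ t : I, Φ (t, 1) = Φ (t, 0) := fun t => by
    show P (Q (t, 1)) = P (Q (t, 0))
    rw [show Q (t, 1) = Q (t, 0) from Subtype.ext (hq1 t)]
  have hΦ00 : Φ (0, 0) = s' := pointForm_injective ℂ n d (by
    rw [hΦform, hs']
    simp only [Set.Icc.coe_zero]
    rw [hq00]; simp)
  -- the track `α`, the `g'`-circle `c₁`
  let α : Path s' (Φ (1, 0)) :=
    { toFun := fun t => Φ (t, 0)
      continuous_toFun := Φ.continuous.comp (Continuous.prodMk continuous_id continuous_const)
      source' := hΦ00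
      target' := rfl }
  let c₁ : Path (Φ (1, 0)) (Φ (1, 0)) :=
    { toFun := fun θ => Φ (1, θ)
      continuous_toFun := Φ.continuous.comp (Continuous.prodMk continuous_const continuous_id)
      source' := rfl
      target' := hΦ1 1 }
  have hrel : loopClassUniv n d γ =
      (Path.Homotopic.Quotient.mk (α.map (toUniv n d).continuous)).trans
        ((loopClassUniv n d c₁).trans (Path.Homotopic.Quotient.mk (α.map (toUniv n d).continuous)).symm) := by
    refine MeridianConj.mk_eq_conj_of_square ((toUniv n d).comp Φ) (γ.map (toUniv n d).continuous)
      (c₁.map (toUniv n d).continuous) (α.map (toUniv n d).continuous) (fun θ => ?_) (fun θ => rfl)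
      (fun t => rfl) (fun t => ?_)
    · show toUniv n d (Φ (0, θ)) = toUniv n d (γ θ)
      congr 1
      apply pointForm_injective ℂ n d
      rw [hΦform, hγ θ]
      simp only [Set.Icc.coe_zero]
      rw [hq0θ]; simp [hwdef]
    · show toUniv n d (Φ (t, 1)) = toUniv n d (Φ (t, 0))
      rw [hΦ1]
  have hrel' : loopClassUniv n d γ = loopClassUniv n d ((α.trans c₁).trans α.symm) := by
    rw [loopClassUniv_trans_trans_symm]; exact hrel
  -- the monomial data on `c₁` (rider carried over from `γ`)
  have hs₁ : pointForm ℂ n d (Φ (1, 0)) = f₁ + (ε : ℂ) • (a' • X i ^ d) := by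
    rw [hΦform]
    simp only [Set.Icc.coe_zero, Set.Icc.coe_one]
    rw [hq10]; simp [hg'def]
  have hc₁ : IsPencilCircle n d f₁ (a' • X i ^ d) ε c₁ := by
    intro θ
    show pointForm ℂ n d (Φ (1, θ)) = _
    rw [hΦform]
    simp only [Set.Icc.coe_one]
    rw [hq1θ]; simp [hwdef, hg'def]
  have hrider₁ : Even n → ∀ T : bettiCohomology (fiberOver (family ℂ n d) (Φ (1, 0))) n ≃ₗ[ℚ]
      bettiCohomology (fiberOver (family ℂ n d) (Φ (1, 0))) n,
      IsRatTransport (family ℂ n d) n hU (loopClassUniv n d c₁) T → T ≠ LinearEquiv.refl ℚ _ := by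
    intro hev T hT hT1
    subst hT1
    obtain ⟨K, hK⟩ := exists_isRatTransport_family hd n hU
      (Path.Homotopic.Quotient.mk (α.map (toUniv n d).continuous))
    have hγT := isRatTransport_conj_of_loopClassUniv_eq hU hrel hK hT
    have hγT' : IsRatTransport (family ℂ n d) n hU (loopClassUniv n d γ) (LinearEquiv.refl ℚ _) := by
      convert hγT using 1; ext v; exact (K.symm_apply_apply v).symm
    exact hrider hev _ hγT' rfl
  obtain ⟨δ₁, c₀, hPL₁⟩ := hM hU ε hε hεM (Φ (1, 0)) hs₁ c₁ hc₁ hrider₁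
  -- carry the data back along the track
  obtain ⟨δ', c', h'⟩ := hPL₁.exists_of_leash α
  refine ⟨δ' 0, c', ?_⟩
  have e : (![δ' 0] : Fin 1 → bettiCohomology (fiberOver (family ℂ n d) s') n) = δ' := by
    funext j; fin_cases j; rfl
  rw [e]
  exact h'.of_loopClassUniv_eq hrel'

/-! ### §2 `picardLefschetz_exchangedPair` is a theorem -/

/-- **The exchanged-pair Picard–Lefschetz binder `picardLefschetz_exchangedPair` HOLDS**: two commuting one-node meridians
(`picardLefschetz_exchangedPair_of_oneNode`) over the now-proved one-node binder.
[cite: VoisinHodgeII2003, §3.2.1 Thm. 3.16, Cor. 3.17, Rem. 3.21 and §2.3.2] [cite: ArnoldGuseinzadeVarchenko2012, Part I §1.3 and §2.1]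
[cite: Lamotke1981, §6] -/
theorem picardLefschetz_exchangedPair_holds : picardLefschetz_exchangedPair :=
  picardLefschetz_exchangedPair_of_oneNode picardLefschetz_oneNode_holds

end Literature.AlgebraicGeometry.HodgeTheory

end
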